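import Summits.CriticalPhenomena.PercolationContinuityZ3.Theorems.PercNearOneGluingNoHeavyPcintBFibDominating
import Summits.CriticalPhenomena.PercolationContinuityZ3.Theorems.PercNearOneGluingNoHeavyPcintBFibBridgeF
import Literature.Probability.Percolation.ThetaContinuityGraph
import Literature.Probability.Percolation.SharpnessQuasiTransitiveMeanField
import Literature.Probability.Percolation.BernoulliPercolationProofs
import Literature.Probability.Percolation.CoveringStrictMonotonicityAssembly
import Literature.Probability.Percolation.BondTriangularUpperBound
import HarnessLib

/-!
# PCINT lane, T-fibre route PHASE 3 assembled: `p_c^bond(𝕋 × F) ≤ p` from the size law of a growth rule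

Cell `prim-pcint`, seat `prim-pcint-1` (gen 13); memo `run/shared/lean/prim/pcint/T-FIBRE-ROUTE.md` (PHASE 3).

The bond analogue of `…PcintUFibAssembly.lean`.  BOND percolation on the triangular lattice `𝕋` at
`s > 2 sin(π/18) ≥ p_c^bond(𝕋)` (`BondTri.criticalProb_triGraph_le`, Grimmett Thm (11.116)) percolates.  The edge exploration
of its cluster inside the ball `B_𝕋(0, n)` (`EdgeExpl.rule`) is dominated step-wise by the bond fibre process on `𝕋 × F` at
density `p` (`BFib.dominating`, from the root inequality and the `15` tail inequalities of the size law of the growth rule), so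
by the coupling-free domination theorem `AdaptDom.expect_le_of_dominating`, the soundness of the process
(`BFib.exists_joined_of_reach`) and the two bridges (`EdgeExpl.real_armEvent_le_sum_wt_reach`,
`BFib.sum_pw_joinedInd_le_real_armEvent`),

  `P_s^𝕋(0 ⟷ ∂B(0,n)) ≤ π_p(all root bits)⁻¹ · P_p^{𝕋×F}((0,i₀) ⟷ ∂B((0,i₀), n))`   (`BFib.armEvent_le`),

hence `θ^bond_𝕋(s) ≤ C θ^bond_{𝕋×F}((0,i₀), p)` and **`BFib.criticalProb_lfib_le_of_table` : `p_c^bond(𝕋 × F) ≤ p`**.  The data of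
the growth rule (edge key `ek`, rule `grow`, its soundness, root cell `i₀`, connectedness of `F` from `i₀`) are explicit
hypotheses; the numeric bound
`2 sin(π/18) < 3473/10⁴` is `two_mul_sin_pi_div_eighteen_lt` (from `sin 3x = 3 sin x − 4 sin³ x` at `x = π/18`).
-/

noncomputable section

namespace Summit.CriticalPhenomena.PercolationContinuityZ3.Theorems.Pcint

namespace BFib

open Finset Filter MeasureTheory AdaptDom EdgeExpl UFib Literature.Probability.Percolation Literature.Probability.LatticeModels

variable {Φ : Type} [Fintype Φ] [DecidableEq Φ] (FA : SimpleGraph Φ) [DecidableRel FA.Adj]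

/-! ### The numeric input `2 sin(π/18) < 0.3473` -/

/-- **`2 sin(π/18) < 3473/10⁴`**: `t = 2 sin(π/18)` is the root in `(0, 1)` of `t³ − 3t + 1` (triple-angle formula at
`π/18`), a polynomial decreasing on `[0, 1]` and already negative at `3473/10⁴`. -/
theorem two_mul_sin_pi_div_eighteen_lt : 2 * Real.sin (Real.pi / 18) < 3473 / 10000 := by
  set t := 2 * Real.sin (Real.pi / 18) with ht
  have h3 : Real.sin (3 * (Real.pi / 18)) = 3 * Real.sin (Real.pi / 18) - 4 * Real.sin (Real.pi / 18) ^ 3 :=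
    Real.sin_three_mul _
  have h6 : 3 * (Real.pi / 18) = Real.pi / 6 := by ring
  rw [h6, Real.sin_pi_div_six] at h3
  have hcubic : t ^ 3 - 3 * t + 1 = 0 := by rw [ht]; nlinarith [h3]
  have hx0 : 0 < Real.pi / 18 := by positivity
  have hsin_lt : Real.sin (Real.pi / 18) < Real.pi / 18 := Real.sin_lt hx0
  have hpi : Real.pi < 3.15 := Real.pi_lt_d2
  have ht1 : t < 7 / 20 := by rw [ht]; linarith
  have ht0 : 0 < t := by
    rw [ht]
    have : 0 < Real.sin (Real.pi / 18) := Real.sin_pos_of_pos_of_lt_pi hx0 (by linarith [Real.pi_pos])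
    linarith
  by_contra hge
  push Not at hge
  -- on `[3473/10⁴, 7/20]` the cubic is negative
  nlinarith [hcubic, mul_nonneg (sub_nonneg.2 hge) (sub_nonneg.2 ht1.le), sq_nonneg t, ht0]

/-! ### The growth data (hypotheses of this file)

An edge key `ek` (symmetric on adjacent pairs, valued in the two orientations), a growth rule `grow` returning cells joined
to the entry cell by open internal edges (keyed by `ek`), and a root cell `i₀` from which `F` is connected. -/

variable {FA} {ek : Φ → Φ → Φ × Φ} {grow : (Φ × Φ → Bool) → Φ → Finset Φ} {i₀ : Φ}
  (hek_comm : ∀ a b, FA.Adj a b → ek a b = ek b a)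
  (hek_mem : ∀ a b, FA.Adj a b → ek a b = (a, b) ∨ ek a b = (b, a))
  (hgrow : ∀ (y : Φ × Φ → Bool) (i j : Φ), j ∈ grow y i →
    Relation.ReflTransGen (fun a b => FA.Adj a b ∧ y (ek a b) = true) i j)
  (hconn : ∀ j, Relation.ReflTransGen FA.Adj i₀ j)
include hek_comm hek_mem hgrow hconn

/-! ### The box inequality -/

section Box

variable (pU sU : unitInterval) (hp : 0 < (pU : ℝ)) (n : ℕ)
  (hdom : ∀ (Λ : Finset (Site 2)) (enc : ↥Λ → ℕ) (o : ↥Λ),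
    Dominating (sU : ℝ) (rule o enc) (muB (Φ := Φ) o (pU : ℝ)) (outB o enc grow))
include hp hdom

/-- **The box inequality**: `P_s^𝕋(0 ⟷ ∂B(0,n)) ≤ π_p(blkAll)⁻¹ · P_p^{𝕋×F}((0,i₀) ⟷ ∂B((0,i₀), n))`. -/
theorem armEvent_le :
    (bondPercolation triGraph sU).real (DCTQ.armEvent triGraph (0 : Site 2) n) ≤
      (1 / wt (pU : ℝ) (blkAll : Blk Φ)) *
        (bondPercolation (lfib FA) pU).real (DCTQ.armEvent (lfib FA) ((0 : Site 2), i₀) n) := by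
  classical
  set Λ := DCTQ.ball triGraph (0 : Site 2) n with hΛ
  have h0 : (0 : Site 2) ∈ Λ := DCTQ.mem_ball_self _ _
  set o : ↥Λ := ⟨0, h0⟩ with ho
  set B := Λ.attach.filter fun v => v.1 ∈ innerBoundary triGraph Λ with hB
  let enc : ↥Λ → ℕ := fun _ => 0
  set N := Fintype.card ↥(EΛ triGraph Λ) + 1 with hN
  let ω₀ : ↥(EΛ triGraph Λ) → Bool := fun _ => false
  have hC : 0 < 1 / wt (pU : ℝ) (blkAll : Blk Φ) := div_pos one_pos (wt_blkAll_pos hp)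
  -- (a) the `𝕋` side
  have ha := real_armEvent_le_sum_wt_reach (G := triGraph) (v := (0 : Site 2)) (n := n) sU
  -- (b) adaptive domination
  have hb := expect_le_of_dominating sU.2.1 sU.2.2 (reachInd_mono (G := triGraph) (o := o) B) (rule o enc)
    (rule_unrevealed (o := o) (enc := enc)) (muB o (pU : ℝ)) (sum_muB hp) (outB o enc grow) (hdom Λ enc o) N ω₀
    (fun w ω => reach_determined B (outB o enc grow w) ω ω₀)
  -- (c) soundness: the payoff of the final state is at most `joinedInd`
  have hc : ∑ w : (↥Λ ⊕ ↥(EΛ triGraph Λ)) → Blk Φ, muB o (pU : ℝ) w *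
        reachInd triGraph o B (merge (run (rule o enc) (outB o enc grow w) N) ω₀) ≤
      ∑ w : (↥Λ ⊕ ↥(EΛ triGraph Λ)) → Blk Φ, (pw (fun _ => wt (pU : ℝ)) w / wt (pU : ℝ) (blkAll : Blk Φ)) *
        joinedInd FA ek o i₀ B w := by
    refine Finset.sum_le_sum fun w _ => ?_
    have hμ := muB_nonneg (o := o) pU.2.1 pU.2.2 hp w
    have hle : reachInd triGraph o B (merge (run (rule o enc) (outB o enc grow w) N) ω₀) ≤ joinedInd FA ek o i₀ B w := by
      unfold reachInd
      split_ifs with hreach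
      · have hval : reachInd triGraph o B (merge (run (rule o enc) (outB o enc grow w) N) ω₀) = 1 := by
          unfold reachInd; rw [if_pos hreach]
        rw [joinedInd_eq_one (exists_joined_of_reach (FA := FA) (ek := ek) (i₀ := i₀) hgrow hconn w B ω₀ hval)]
      · exact (joinedInd_mem o i₀ B w).1
    calc muB o (pU : ℝ) w * reachInd triGraph o B (merge (run (rule o enc) (outB o enc grow w) N) ω₀)
        ≤ muB o (pU : ℝ) w * joinedInd FA ek o i₀ B w := mul_le_mul_of_nonneg_left hle hμ
      _ ≤ (pw (fun _ => wt (pU : ℝ)) w / wt (pU : ℝ) (blkAll : Blk Φ)) * joinedInd FA ek o i₀ B w :=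
          mul_le_mul_of_nonneg_right (muB_le_pw pU.2.1 pU.2.2 hp w) (joinedInd_mem o i₀ B w).1
  -- (d) the fibre side
  have hd := sum_pw_joinedInd_le_real_armEvent (FA := FA) hek_comm hek_mem h0 i₀ pU
  have hcd : ∑ w : (↥Λ ⊕ ↥(EΛ triGraph Λ)) → Blk Φ, (pw (fun _ => wt (pU : ℝ)) w / wt (pU : ℝ) (blkAll : Blk Φ)) *
        joinedInd FA ek o i₀ B w =
      (1 / wt (pU : ℝ) (blkAll : Blk Φ)) * ∑ w : (↥Λ ⊕ ↥(EΛ triGraph Λ)) → Blk Φ, pw (fun _ => wt (pU : ℝ)) w *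
        joinedInd FA ek o i₀ B w := by
    rw [Finset.mul_sum]; exact Finset.sum_congr rfl fun w _ => by ring
  calc (bondPercolation triGraph sU).real (DCTQ.armEvent triGraph (0 : Site 2) n)
      ≤ _ := ha
    _ ≤ _ := hb
    _ ≤ _ := hc
    _ = _ := hcd
    _ ≤ _ := mul_le_mul_of_nonneg_left hd hC.le

/-- **`θ^bond_𝕋(s) ≤ π_p(blkAll)⁻¹ · θ^bond_{𝕋×F}((0,i₀), p)`.** -/
theorem theta_tri_le :
    theta triGraph (0 : Site 2) sU ≤ (1 / wt (pU : ℝ) (blkAll : Blk Φ)) * theta (lfib FA) ((0 : Site 2), i₀) pU := by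
  have hC : 0 < 1 / wt (pU : ℝ) (blkAll : Blk Φ) := div_pos one_pos (wt_blkAll_pos hp)
  have key : wt (pU : ℝ) (blkAll : Blk Φ) * theta triGraph (0 : Site 2) sU ≤ theta (lfib FA) ((0 : Site 2), i₀) pU := by
    refine DCTQ.le_theta_of_forall_le_real_armEvent pU ((0 : Site 2), i₀) fun k => ?_
    have h1 := VdBK.theta_le_real_armEvent triGraph (0 : Site 2) sU k
    have h2 := armEvent_le hek_comm hek_mem hgrow hconn pU sU hp k hdom
    have hZ := wt_blkAll_pos (Φ := Φ) hp
    calc wt (pU : ℝ) (blkAll : Blk Φ) * theta triGraph (0 : Site 2) sU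
        ≤ wt (pU : ℝ) (blkAll : Blk Φ) * ((1 / wt (pU : ℝ) (blkAll : Blk Φ)) *
            (bondPercolation (lfib FA) pU).real (DCTQ.armEvent (lfib FA) ((0 : Site 2), i₀) k)) :=
          mul_le_mul_of_nonneg_left (h1.trans h2) hZ.le
      _ = (bondPercolation (lfib FA) pU).real (DCTQ.armEvent (lfib FA) ((0 : Site 2), i₀) k) := by
          field_simp
  calc theta triGraph (0 : Site 2) sU
      = (1 / wt (pU : ℝ) (blkAll : Blk Φ)) * (wt (pU : ℝ) (blkAll : Blk Φ) * theta triGraph (0 : Site 2) sU) := by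
        have hZ := wt_blkAll_pos (Φ := Φ) hp; field_simp
    _ ≤ _ := mul_le_mul_of_nonneg_left key hC.le

/-- **`p_c^bond(𝕋 × F) ≤ p`** whenever `s > 2 sin(π/18)` (so that `θ^bond_𝕋(s) > 0`). -/
theorem criticalProb_lfib_le (hs : 2 * Real.sin (Real.pi / 18) < sU) :
    criticalProb (lfib FA) ((0 : Site 2), i₀) ≤ pU := by
  have hpc : criticalProb triGraph (0 : Site 2) < sU := (BondTri.criticalProb_triGraph_le 0).trans_lt hs
  have hθT : 0 < theta triGraph (0 : Site 2) sU := theta_pos_of_criticalProb_lt_holds triGraph 0 sU hpc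
  have hC : 0 < 1 / wt (pU : ℝ) (blkAll : Blk Φ) := div_pos one_pos (wt_blkAll_pos hp)
  have hpos : 0 < theta (lfib FA) ((0 : Site 2), i₀) pU := by
    have h := theta_tri_le hek_comm hek_mem hgrow hconn pU sU hp hdom
    by_contra hle
    have h0 : theta (lfib FA) ((0 : Site 2), i₀) pU = 0 :=
      le_antisymm (not_lt.1 hle) (by unfold theta; exact measureReal_nonneg)
    rw [h0, mul_zero] at h
    exact absurd h (not_le.2 hθT)
  exact OrbitQuotient.criticalProb_le_of_theta_pos (lfib FA) _ pU hpos

end Box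

/-! ### The criterion with the size law -/

/-- **The PHASE-3 criterion**: for growth data whose size law `law` does not depend on the entry cell (`hlaw`), numbers
`0 < p ≤ 1`, `s = 3473/10⁴` with `s ≤ 1 - (1-p)^{#Φ}` and the `15` tail inequalities (`k ≤ 5`),
`p_c^bond(𝕋 × F)((0, i₀)) ≤ p`. -/
theorem criticalProb_lfib_le_of_table (p : ℝ) (hp0 : 0 < p) (hp1 : p ≤ 1) (law : ℕ → ℝ)
    (hlaw : ∀ (i : Φ) (G : ℕ → ℝ), ∑ y : Φ × Φ → Bool, wt p y * G (grow y i).card =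
      ∑ u ∈ range (Fintype.card Φ + 1), law u * G u)
    (hroot : (3473 : ℝ) / 10000 ≤ 1 - (1 - p) ^ Fintype.card Φ)
    (htable : ∀ k : ℕ, k ≤ 5 → ∀ j, 1 ≤ j → j ≤ k →
      (∑ u ∈ range (Fintype.card Φ + 1), law u) * binTail k (3473 / 10000) j ≤
        ∑ u ∈ range (Fintype.card Φ + 1), law u * binTail k (1 - (1 - p) ^ u) j) :
    criticalProb (lfib FA) ((0 : Site 2), i₀) ≤ p := by
  have h := criticalProb_lfib_le hek_comm hek_mem hgrow hconn ⟨p, hp0.le, hp1⟩ ⟨3473 / 10000, by norm_num, by norm_num⟩ hp0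
    (fun Λ enc o => dominating grow p law hlaw hp0 hp1 (s := 3473 / 10000) (by norm_num) (by norm_num) hroot htable i₀)
    (by simpa using two_mul_sin_pi_div_eighteen_lt)
  simpa using h

end BFib

end Summit.CriticalPhenomena.PercolationContinuityZ3.Theorems.Pcint

end
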